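import Literature.Analysis.OperatorTheory.PositiveKernelSpectralTraceTwo

/-!
# Crux `DiagonalMirrorRPR` (stmt-QuantumFields-10604), line `sign-twisted-diagonal-trace`, construction F1_diag
# (director-ym O4 WORD 3 (A)), S4e₁: signed trace formulas `Σᵢ λᵢ^{M+2} = Tr A^{M+2}` (no sign condition on the eigenvalues)

Helper for the crux `DiagonalMirrorRPR` of `YangMills` (routes `IsotropyFromPowerCounting`, `MirrorModularBoosts`,
`PencilRigidity`; item stmt-QuantumFields-10604), attached `--supports … --as helper`; it closes nothing by itself.

The tree's trace formulas for the cyclic integrals of a bounded symmetric kernel on a finite measure space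
(`Literature.Analysis.OperatorTheory.hasSum_pow_integral_iterate_diag`, `…hasSum_pow_integral_cyclic`) assume non-negative
eigenvalues (monotone interchange).  The lifted kernel of the Wilson diagonal two-step transfer matrix (`natKernel`, files
`…WilsonDiagonalModelNatKernel*`) has eigenvalues of BOTH signs — its positive and negative parts are exactly the `sp` / `sm`
data of `DiagonalSliceModel`.  This file removes the sign hypothesis (dominated interchange: `∫ |λᵢ^M (κbᵢ)²| = |λᵢ|^{M+2}` is
summable by `summable_abs_lam_pow`):

* `hasSum_pow_integral_iterate_diag_signed` — `Σᵢ λᵢ^{M+2} = ∫ (κ^[M+1] K(·,x))(x) dμ`;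
* `hasSum_pow_integral_cyclic_signed` — `Σᵢ λᵢ^{M+2} = ∫ ∏_{t : Fin (M+2)} K(V t, V (t+1)) dμ^{⊗(M+2)}`.

General operator theory (pure Mathlib + `Literature/Analysis/OperatorTheory`); relocatable to that directory.  NEXT (S4e₂):
apply it to the bounded reweighted kernel `𝔟 = 𝔞 / (√w ⊗ √w)` on the finite measure `(w · counting) ⊗ halfHaar`
(`w_k = ψ_k(M⃗)² + 2^{-k-1}`), whose cyclic integrals are `Σ'_k ∫_X ∏_t 𝔞 = diagCyclicTraceU ρ β m` (`…ChainKernel`).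
HONEST FRAMING: construction helper; no `def wilsonDiagonalModel`; nothing about D_old ⟨10604⟩, the RP crux of the FOLD
restate, or the summit is proved; the Yang–Mills mass gap is NOT proved here or anywhere in the tree.

References: M. Reed, B. Simon, *Methods of Modern Mathematical Physics I* (1980) Thm. VI.22–23; B. Simon, *Trace Ideals and
Their Applications* (2005) Thm. 3.1.
-/

set_option autoImplicit false

noncomputable section

open MeasureTheory Filter Set Function
open Literature.Analysis.OperatorTheory
open scoped RealInnerProductSpace ENNReal

namespace Summit.QuantumFields.YangMills.Cruxes.DiagonalMirrorRPR.SignTwistedDiagonalTrace.WilsonDiagonal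

/-! ## §29 Signed trace formulas `Σᵢ λᵢ^{M+2} = Tr A^{M+2}` for a bounded symmetric kernel (no sign condition on `λᵢ`) -/

section SignedTrace

variable {X : Type*} [MeasurableSpace X] {μ : Measure X} [IsFiniteMeasure μ]
  {K : X → X → ℝ} {C : ℝ} {A : Lp ℝ 2 μ →L[ℝ] Lp ℝ 2 μ} {ι : Type*}
  {b : HilbertBasis ι ℝ (Lp ℝ 2 μ)} {lam : ι → ℝ}

/-- **Trace of powers, signed eigenvalues.**  For a bounded symmetric strongly measurable kernel `K` on a finite measure
space, its `L²` operator `A` (`A φ =ᵐ ∫ K(·,y) φ(y)`) and a Hilbert basis of eigenvectors `A bᵢ = λᵢ bᵢ` (eigenvalues of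
EITHER sign), `Σᵢ λᵢ^{M+2} = ∫ (κ^[M+1] K(·, x))(x) dμ(x)` (`HasSum`; absolutely convergent since `Σ |λᵢ|^{M+2} ≤ ‖A‖^M Σ λᵢ²`).
This is `Literature.Analysis.OperatorTheory.hasSum_pow_integral_iterate_diag` with its hypothesis `0 ≤ λᵢ` removed
(dominated instead of monotone interchange: `∫ |λᵢ^M (κbᵢ)²| = |λᵢ|^{M+2}` is summable).  General operator theory,
stated here for the Wilson diagonal transfer matrix whose lifted kernel has eigenvalues of both signs; relocatable to
`Literature/Analysis/OperatorTheory/`. [cite: ReedSimonI1980, Thm. VI.22–23] -/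
theorem hasSum_pow_integral_iterate_diag_signed [Countable ι] (hK : StronglyMeasurable (uncurry K))
    (hC : ∀ x y, ‖K x y‖ ≤ C) (hsymm : ∀ x y, K x y = K y x)
    (hA : ∀ φ : Lp ℝ 2 μ, (A φ : X → ℝ) =ᵐ[μ] fun x => ∫ y, K x y * φ y ∂μ)
    (hb : ∀ i, A (b i) = lam i • b i) (M : ℕ) :
    HasSum (fun i => lam i ^ (M + 2))
      (∫ x, ((fun f : X → ℝ => fun w => ∫ z, K w z * f z ∂μ)^[M + 1] (fun z => K z x)) x ∂μ) := by
  set c : ι → X → ℝ := fun i x => ∫ z, K x z * b i z ∂μ with hc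
  set f : ι → X → ℝ := fun i x => lam i ^ M * c i x ^ 2 with hf
  have hcm : ∀ i, Measurable (c i) := fun i => measurable_integral_kernel_mul_basis hK b i
  have hfm : ∀ i, Measurable (f i) := fun i => ((hcm i).pow_const 2).const_mul _
  have habs : ∀ i x, |f i x| = |lam i| ^ M * c i x ^ 2 := fun i x => by
    rw [hf]; dsimp only; rw [abs_mul, abs_pow, abs_pow, sq_abs]
  -- pointwise expansion of the integrand (Parseval for the sections; every `x`)
  have hpt : ∀ x, HasSum (fun i => f i x)
      (((fun f : X → ℝ => fun w => ∫ z, K w z * f z ∂μ)^[M + 1] (fun z => K z x)) x) := fun x => by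
    rw [iterate_kernel_eq_inner hK hC hsymm hA M x x]
    have h := hasSum_inner_kernel_section_pow hK hC hsymm hA hb M x x
    simp only [hf, hc, sq]
    convert h using 2 with i
    ring
  have hint_eq : ∀ x, ((fun f : X → ℝ => fun w => ∫ z, K w z * f z ∂μ)^[M + 1] (fun z => K z x)) x =
      ∑' i, f i x := fun x => (hpt x).tsum_eq.symm
  simp_rw [hint_eq]
  -- each term integrates to `λᵢ^{M+2}`, its modulus to `|λᵢ|^{M+2}`
  have hfi : ∀ i, ∫ x, f i x ∂μ = lam i ^ (M + 2) := fun i => by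
    simp only [hf]
    rw [integral_const_mul, integral_sq_integral_kernel_mul_basis hK hC hA hb i, ← pow_add]
  have hafi : ∀ i, ∫ x, |f i x| ∂μ = |lam i| ^ (M + 2) := fun i => by
    simp_rw [habs i]
    rw [integral_const_mul, integral_sq_integral_kernel_mul_basis hK hC hA hb i, ← sq_abs (lam i), ← pow_add]
  have hfint : ∀ i, Integrable (f i) μ := fun i => by
    refine Integrable.of_bound (hfm i).aestronglyMeasurable (‖A‖ ^ M * (C ^ 2 * μ.real univ))
      (Eventually.of_forall fun x => ?_)
    rw [Real.norm_eq_abs, habs]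
    refine mul_le_mul (pow_le_pow_left₀ (abs_nonneg _) (abs_lam_le_norm hb i) M) ?_ (sq_nonneg _) (by positivity)
    obtain ⟨hsx, hlex⟩ := tsum_sq_integral_kernel_mul_le (μ := μ) hK hC b x
    exact (hsx.le_tsum i fun j _ => sq_nonneg _).trans hlex
  have hsabs : Summable fun i => |lam i| ^ (M + 2) := summable_abs_lam_pow hK hC hA hb M
  have hsum : Summable fun i => lam i ^ (M + 2) :=
    Summable.of_abs (hsabs.congr fun i => (abs_pow (lam i) (M + 2)).symm)
  have hlint : ∑' i, ∫⁻ x, ‖f i x‖ₑ ∂μ ≠ ∞ := by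
    have h1 : ∀ i, ∫⁻ x, ‖f i x‖ₑ ∂μ = ENNReal.ofReal (|lam i| ^ (M + 2)) := fun i => by
      rw [← hafi i, ofReal_integral_eq_lintegral_ofReal (hfint i).abs (Eventually.of_forall fun x => abs_nonneg _)]
      exact lintegral_congr fun x => Real.enorm_eq_ofReal_abs _
    simp_rw [h1]
    rw [← ENNReal.ofReal_tsum_of_nonneg (fun i => by positivity) hsabs]
    exact ENNReal.ofReal_ne_top
  rw [integral_tsum (fun i => (hfm i).aestronglyMeasurable) hlint]
  simp_rw [hfi]
  exact hsum.hasSum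

/-- **`Tr A^{M+2}` as a periodic path integral, signed eigenvalues**:
`Σᵢ λᵢ^{M+2} = ∫ ∏_{t : Fin (M+2)} K(V t, V (t+1)) dμ^{⊗(M+2)}(V)` — `Literature.Analysis.OperatorTheory.hasSum_pow_integral_cyclic`
without the hypothesis `0 ≤ λᵢ`. [cite: ReedSimonI1980, Thm. VI.22–23] -/
theorem hasSum_pow_integral_cyclic_signed [Countable ι] (hK : StronglyMeasurable (uncurry K))
    (hC : ∀ x y, ‖K x y‖ ≤ C) (hsymm : ∀ x y, K x y = K y x)
    (hA : ∀ φ : Lp ℝ 2 μ, (A φ : X → ℝ) =ᵐ[μ] fun x => ∫ y, K x y * φ y ∂μ)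
    (hb : ∀ i, A (b i) = lam i • b i) (M : ℕ) :
    HasSum (fun i => lam i ^ (M + 2))
      (∫ V : Fin (M + 2) → X, ∏ t, K (V t) (V (t + 1)) ∂(Measure.pi fun _ => μ)) := by
  have h := hasSum_pow_integral_iterate_diag_signed hK hC hsymm hA hb M
  set κ : (X → ℝ) → X → ℝ := fun f w => ∫ z, K w z * f z ∂μ with hκ
  have hc := integral_cyclic_eq_integral_iterate (ρ := μ) hK.measurable hC M 0 (F := fun _ => (1 : ℝ))
    (G := fun _ => (1 : ℝ)) measurable_const measurable_const (BF := 1) (BG := 1) (by simp) (by simp)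
    ⟨1, by omega⟩ rfl
  simp only [one_mul] at hc
  have hc2 : ∀ x, (κ^[0 + 1]) (fun y => (κ^[M]) (fun z => K z x) y) x = (κ^[M + 1]) (fun z => K z x) x := by
    intro x
    have e : (fun y => (κ^[M]) (fun z => K z x) y) = (κ^[M]) (fun z => K z x) := rfl
    rw [e, ← Function.iterate_add_apply, show 0 + 1 + M = M + 1 by omega]
  have hc' : ∫ V : Fin (M + 2) → X, ∏ t, K (V t) (V (t + 1)) ∂(Measure.pi fun _ => μ) =
      ∫ x, (κ^[M + 1]) (fun z => K z x) x ∂μ :=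
    calc ∫ V : Fin (M + 2) → X, ∏ t, K (V t) (V (t + 1)) ∂(Measure.pi fun _ => μ)
          = ∫ x, (κ^[0 + 1]) (fun y => (κ^[M]) (fun z => K z x) y) x ∂μ := hc
      _ = ∫ x, (κ^[M + 1]) (fun z => K z x) x ∂μ := integral_congr_ae (ae_of_all _ hc2)
  rw [hc']
  exact h

end SignedTrace

end Summit.QuantumFields.YangMills.Cruxes.DiagonalMirrorRPR.SignTwistedDiagonalTrace.WilsonDiagonal

end
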